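import Literature.Computability.QuantumComplexity.PolyCopies
import Literature.Computability.QuantumComplexity.CWrapAssembly
import Literature.Computability.QuantumComplexity.OracleSubstitution
import Literature.Computability.Complexity.PostBPPHashLanguage
import HarnessLib

/-!
# BQP error reduction to inverse-polynomial error (Bennett–Bernstein–Brassard–Vazirani 1997, Thm. 4.13 with polynomially many copies)

Topic `Literature/Computability/QuantumComplexity`; sequel of `PolyCopies.lean` (the uniform
`K(n)`-copy family and its output law), in the style of `BQPMajorityAmplification.lean` (which votes
over a *constant* number of copies). The printed boosting (BBBV, proof of Thm. 4.13): "run `k`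
independent copies of `M` and then take the vote of the `k` answers … just like taking the majority of
`k` independent coin flips each with probability at least `2/3` of heads … when `k = b log 1/ε`, the
probability of seeing the correct answer will be at least `1 − ε`." Here `k = K(n)` is a polynomial of
the input length, which gives every inverse-polynomial error (the precision the tidy subroutines of
Thm. 4.14 / Cor. 4.15 need).

* `PolyCopies.majF` — **the majority read-out** as a string function on `⟨x, y⟩` (`y` the measured
  string of the `K(|x|)`-copy family): a counted loop (`Brick.loopStep`, `K(|x|)` rounds) which walks
  over `y` from the first answer position `base |x|` in steps of the block width `b |x|`, collecting
  the answer bits, followed by the comparison `[K(|x|) < 2 · #accepting copies]` (`popCountFn`,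
  `addFn`, `ltFn`); `majF_mem_FP` and its value `majF_boolPair`;
* `PolyCopies.kernelProb_majF_ge` — the `K(n)`-copy family followed by `majF` answers correctly with
  probability `≥ 1 − 1/(4 K(n) η²)` (from `PolyCopies.kernelProb_ge_of_majority`);
* **`exists_poly_amplified`** — for every uniform oracle-free Clifford+T family `F` with advantage
  `η > 0` and every polynomial `pK` there is a uniform oracle-free family with two-sided error
  `≤ 1/(4 (pK(n)+1) η²)` on inputs of length `n`: the `K(n)`-copy family followed by the classical
  wrap `CWrap.family` (`CWrapAssembly.lean`) with post-processor `majF`;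
* **`exists_uniform_family_inv_poly_error`** — in particular every `A ∈ BQP` is decided by a uniform
  oracle-free family with error at most `1/(4 (n+1)²)` on inputs of length `n`.

## References

* C. H. Bennett, E. Bernstein, G. Brassard, U. Vazirani, *Strengths and weaknesses of quantum
  computing*, SIAM J. Comput. 26 (1997) 1510–1523, Thm. 4.13 and its proof (arXiv:quant-ph/9701001,
  p. 12) [BennettBernsteinBrassardVazirani1997].
* E. Bernstein, U. Vazirani, *Quantum complexity theory*, SIAM J. Comput. 26 (1997), §8.2 Thm. 8.5
  (error reduction for `BQP`) [BernsteinVazirani1997].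
* S. Arora, B. Barak, *Computational Complexity: A Modern Approach*, CUP 2009, §1.3 (bounded loops in
  polynomial time) [AroraBarak2009].
-/

noncomputable section

namespace Literature.Computability.QuantumComplexity

namespace PolyCopies

open _root_.Computability Polynomial Complexity Complexity.Brick Plumb HashBricks Cryptography Finset

variable (P : Params)

/-! ### The majority read-out as a string function -/

/-- The body of the read-out loop on records `⟨x, ⟨cnt, ⟨acc, rest⟩⟩⟩`: prepend the first bit of
`rest` (if any) to `acc` and drop one block width `b |x|` of `rest`. [folklore] -/
def majBody : List Bool → List Bool :=
  fanoutFn (appF ∘ fanoutFn (takeFn ∘ fanoutFn (fun _ => [true]) (sndPow 2)) (nthF 2))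
    (dropFn ∘ fanoutFn (polyFn (bPoly P) ∘ nthF 0) (sndPow 2))

/-- The initial record `⟨x, ⟨bin K(|x|), ⟨[], y after the first base |x| bits⟩⟩⟩` from `⟨x, y⟩`.
[folklore] -/
def majInit : List Bool → List Bool :=
  fanoutFn fstF (fanoutFn (lenBinF ∘ polyFn (KPoly P) ∘ fstF)
    (fanoutFn (fun _ => []) (dropFn ∘ fanoutFn (polyFn (basePoly P) ∘ fstF) sndF)))

/-- The read-out loop: `K(|x|)` rounds of `majBody`. [cite: AroraBarak2009, §1.3 (bounded loops)] -/
def majLoop : List Bool → List Bool := fun z => (loopStep (majBody P))^[(KPoly P).eval (fstF z).length] z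

/-- The final comparison `[K(|x|) < 2 · (number of ones collected)]`. [folklore] -/
def majPost : List Bool → List Bool :=
  ltFn ∘ fanoutFn (lenBinF ∘ polyFn (KPoly P) ∘ nthF 0) (addFn ∘ fanoutFn (popCountFn ∘ nthF 2) (popCountFn ∘ nthF 2))

/-- **The majority read-out** of the `K(n)`-copy family: on `⟨x, y⟩`, the bit
`[K(|x|) < 2 · #{j < K(|x|) | y[blk |x| j 0] = 1}]` ("calculate the majority of the `k` answers",
BBBV step 4). [cite: BennettBernsteinBrassardVazirani1997, Thm. 4.13 (proof, step 4)] -/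
def majF : List Bool → List Bool := majPost P ∘ majLoop P ∘ majInit P

variable {P}

/-- Growth of the loop body: the state grows by at most `4` symbols per round. [folklore] -/
theorem length_majBody_le (z : List Bool) : (majBody P z).length ≤ (sndPow 1 z).length + 4 * ((fstF z).length + 1) := by
  have h1 : 2 * (nthF 2 z).length + (sndPow 2 z).length ≤ (sndPow 1 z).length := length_nthF_succ_add_sndPow_succ_le 1 z
  have htake : (takeFn (boolPair [true] (sndPow 2 z))).length ≤ 1 := by
    rw [takeFn_boolPair]; exact (List.length_take_le _ _).trans (by simp)
  have hdrop : (dropFn (boolPair (polyFn (bPoly P) (nthF 0 z)) (sndPow 2 z))).length ≤ (sndPow 2 z).length := by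
    rw [dropFn_boolPair, List.length_drop]; exact Nat.sub_le _ _
  simp only [majBody, fanoutFn_apply, Function.comp_apply, length_boolPair, appF, fstF_boolPair, sndF_boolPair,
    List.length_append]
  omega

/-- `majBody ∈ FP`. [folklore] -/
theorem majBody_mem_FP : majBody P ∈ FP :=
  fanoutFn_mem_FP (comp_mem_FP appF_mem_FP (fanoutFn_mem_FP (comp_mem_FP takeFn_mem_FP (fanoutFn_mem_FP (const_mem_FP _) (sndPow_mem_FP 2)))
    (nthF_mem_FP 2))) (comp_mem_FP dropFn_mem_FP (fanoutFn_mem_FP (comp_mem_FP (polyFn_mem_FP _) (nthF_mem_FP 0)) (sndPow_mem_FP 2)))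

/-- `majInit ∈ FP`. [folklore] -/
theorem majInit_mem_FP : majInit P ∈ FP :=
  fanoutFn_mem_FP fstF_mem_FP (fanoutFn_mem_FP (comp_mem_FP lenBinF_mem_FP (comp_mem_FP (polyFn_mem_FP _) fstF_mem_FP))
    (fanoutFn_mem_FP (const_mem_FP _) (comp_mem_FP dropFn_mem_FP (fanoutFn_mem_FP (comp_mem_FP (polyFn_mem_FP _) fstF_mem_FP) sndF_mem_FP))))

/-- `majLoop ∈ FP`. [cite: AroraBarak2009, §1.3 (bounded loops)] -/
theorem majLoop_mem_FP : majLoop P ∈ FP := loopFn_mem_FP majBody_mem_FP length_majBody_le (KPoly P)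

/-- `majPost ∈ FP`. [folklore] -/
theorem majPost_mem_FP : majPost P ∈ FP :=
  comp_mem_FP ltFn_mem_FP (fanoutFn_mem_FP (comp_mem_FP lenBinF_mem_FP (comp_mem_FP (polyFn_mem_FP _) (nthF_mem_FP 0)))
    (comp_mem_FP addFn_mem_FP (fanoutFn_mem_FP (comp_mem_FP popCountFn_mem_FP (nthF_mem_FP 2)) (comp_mem_FP popCountFn_mem_FP (nthF_mem_FP 2)))))

/-- **The majority read-out is polynomial time.** [cite: BennettBernsteinBrassardVazirani1997, Thm. 4.13 (proof: steps 1 2 4 are easily computable functions)] -/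
theorem majF_mem_FP : majF P ∈ FP := comp_mem_FP majPost_mem_FP (comp_mem_FP majLoop_mem_FP majInit_mem_FP)

/-! ### Semantics of the read-out -/

/-- The data after `i` rounds: `y` with `base n + i · b n` bits dropped. [folklore] -/
def restAt (n : ℕ) (y : List Bool) (i : ℕ) : List Bool := y.drop (base P n + i * b P n)

/-- The collected bits after `i` rounds (latest first). [folklore] -/
def accAt (n : ℕ) (y : List Bool) : ℕ → List Bool
  | 0 => []
  | i + 1 => (restAt (P := P) n y i).take 1 ++ accAt n y i

/-- One round of the body on a well-formed record. [folklore] -/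
theorem majBody_record (x c : List Bool) (y : List Bool) (i : ℕ) :
    majBody P (boolPair x (boolPair c (boolPair (accAt (P := P) x.length y i) (restAt (P := P) x.length y i)))) =
      boolPair (accAt (P := P) x.length y (i + 1)) (restAt (P := P) x.length y (i + 1)) := by
  simp only [majBody, fanoutFn_apply, Function.comp_apply, sndPow_succ_boolPair, sndPow_zero_boolPair, nthF_succ_boolPair,
    nthF_zero_boolPair, takeFn_boolPair, dropFn_boolPair, polyFn_apply, eval_bPoly, appF, fstF_boolPair, sndF_boolPair, accAt,
    restAt, List.drop_drop, ones, List.length_replicate, List.length_singleton]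
  congr 2
  ring

/-- The loop model runs the rounds. [folklore] -/
theorem loopModel_majBody (x : List Bool) (y : List Bool) : ∀ (k i : ℕ),
    loopModel (majBody P) x k (boolPair (accAt (P := P) x.length y i) (restAt (P := P) x.length y i)) =
      boolPair (accAt (P := P) x.length y (i + k)) (restAt (P := P) x.length y (i + k))
  | 0, i => rfl
  | k + 1, i => by
    rw [loopModel, majBody_record, loopModel_majBody x y k (i + 1)]
    congr 2 <;> ring

/-- Counting the collected ones: the number of positions `blk n j 0`, `j < i`, at which `y` reads `1`.
[folklore] -/
theorem count_accAt (n : ℕ) (y : List Bool) : ∀ i : ℕ,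
    (accAt (P := P) n y i).count true = ((Finset.range i).filter fun j => y.getD (blk P n j 0) false = true).card
  | 0 => by simp [accAt]
  | i + 1 => by
    rw [accAt, List.count_append, count_accAt n y i, Finset.range_add_one, Finset.filter_insert]
    have hpos : blk P n i 0 = base P n + i * b P n := by unfold blk; omega
    have htake : ((restAt (P := P) n y i).take 1).count true = if y.getD (blk P n i 0) false = true then 1 else 0 := by
      rw [restAt, hpos.symm, List.getD_eq_getElem?_getD]
      cases h : y.drop (blk P n i 0) with
      | nil =>
        have : y[blk P n i 0]? = none := by
          rw [List.getElem?_eq_none]; exact List.drop_eq_nil_iff.1 h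
        simp [this]
      | cons a l =>
        have : y[blk P n i 0]? = some a := by
          have e := List.getElem?_drop (xs := y) (i := blk P n i 0) (j := 0)
          rw [h, Nat.add_zero] at e
          simpa using e.symm
        rw [this]
        cases a <;> simp
    rw [htake]
    split_ifs with h
    · rw [Finset.card_insert_of_notMem (fun h' => Finset.notMem_range_self (Finset.mem_filter.1 h').1)]
      omega
    · omega

/-- The number of copies `j < K n` whose answer position reads `1`. [folklore] -/
def accCount (x y : List Bool) : ℕ := ((Finset.range (K P x.length)).filter fun j => y.getD (blk P x.length j 0) false = true).card

/-- **Semantics of the majority read-out.** [cite: BennettBernsteinBrassardVazirani1997, Thm. 4.13 (proof, step 4: the majority of the k answers)] -/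
theorem majF_boolPair (x y : List Bool) : majF P (boolPair x y) = [decide (K P x.length < 2 * accCount (P := P) x y)] := by
  have hinit : majInit P (boolPair x y) =
      boolPair x (boolPair (encodeNat (K P x.length)) (boolPair (accAt (P := P) x.length y 0) (restAt (P := P) x.length y 0))) := by
    simp [majInit, fanoutFn_apply, accAt, restAt, ones]
  have hloop : majLoop P (majInit P (boolPair x y)) =
      boolPair x (boolPair [] (boolPair (accAt (P := P) x.length y (K P x.length)) (restAt (P := P) x.length y (K P x.length)))) := by
    rw [majLoop, hinit, fstF_boolPair, eval_KPoly, iterate_loopStep (majBody P) x (K P x.length) (K P x.length) _ le_rfl,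
      loopModel_majBody x y (K P x.length) 0, Nat.zero_add]
  rw [majF, Function.comp_apply, Function.comp_apply, hloop]
  simp only [majPost, Function.comp_apply, fanoutFn_apply, nthF_zero_boolPair, nthF_succ_boolPair, polyFn_apply, eval_KPoly,
    lenBinF_apply, ones, List.length_replicate, popCountFn_apply, ltFn_boolPair, addFn_boolPair, bitsToNat_encodeNat,
    count_accAt, accCount, two_mul]

/-! ### The read-out is right with probability `≥ 1 − 1/(4 K(n) η²)` -/

/-- The accept count read off the measured string. [folklore] -/
theorem accCount_ofFn (x : List Bool) (z : QReg (x.length + anc P x.length)) :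
    accCount (P := P) x (List.ofFn z) = (univ.filter fun j : Fin (K P x.length) => z (ansW x.length j) = true).card := by
  unfold accCount
  rw [← PostBPPHash.card_filter_fin (K P x.length) (fun j => (List.ofFn z).getD (blk P x.length j 0) false = true)]
  congr 1
  refine Finset.filter_congr fun j _ => ?_
  rw [getD_ofFn_ansW]

/-- Counting: a strict majority of copies answering `c` decides the comparison. [folklore] -/
theorem decide_lt_two_mul_of_majority (c : Bool) {Kn : ℕ} (s : Fin Kn → Bool)
    (h : ¬ 2 * (univ.filter fun j => s j = c).card ≤ Kn) :
    decide (Kn < 2 * (univ.filter fun j => s j = true).card) = c := by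
  have hsum := Finset.card_filter_add_card_filter_not (s := (univ : Finset (Fin Kn))) (fun j => s j = true)
  simp only [Finset.card_univ, Fintype.card_fin] at hsum
  have hneg : (univ.filter fun j => ¬ s j = true).card = (univ.filter fun j => s j = false).card :=
    congrArg Finset.card (Finset.filter_congr fun j _ => by simp)
  cases c
  · rw [hneg] at hsum
    exact decide_eq_false (by omega)
  · exact decide_eq_true (by omega)

/-- **The `K(n)`-copy family followed by the majority read-out answers `c` with probability at least
`1 − 1/(4 K(n) η²)`** whenever one copy answers `c` with probability at least `1/2 + η`.
[cite: BennettBernsteinBrassardVazirani1997, Thm. 4.13 (proof)] -/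
theorem kernelProb_majF_ge (x : List Bool) (c : Bool) {η : ℝ} (hη : 0 < η)
    (hgood : 1 / 2 + η ≤ ∑ v ∈ univ.filter (fun v : QReg (b P x.length) => v ⟨0, b_pos x.length⟩ = c), ‖blockState P x v‖ ^ 2) :
    1 - 1 / (4 * K P x.length * η ^ 2) ≤ (family P).kernelProb 0 x {y | majF P (boolPair x y) = [c]} := by
  classical
  refine kernelProb_ge_of_majority x c hη hgood _ fun z hz => ?_
  rw [Set.mem_setOf_eq, majF_boolPair, accCount_ofFn]
  congr 1
  exact decide_lt_two_mul_of_majority c (fun j => z (ansW x.length j)) hz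

/-- **Yes-instances.** [cite: BennettBernsteinBrassardVazirani1997, Thm. 4.13 (proof)] -/
theorem kernelProb_majF_true_ge (x : List Bool) {η : ℝ} (hη : 0 < η) (hx : 1 / 2 + η ≤ P.F.acceptProbOn 0 x) :
    1 - 1 / (4 * K P x.length * η ^ 2) ≤ (family P).kernelProb 0 x {y | majF P (boolPair x y) = [true]} :=
  kernelProb_majF_ge x true hη (by rw [sum_filter_blockState_wire0]; exact hx)

/-- **No-instances.** [cite: BennettBernsteinBrassardVazirani1997, Thm. 4.13 (proof)] -/
theorem kernelProb_majF_false_ge (x : List Bool) {η : ℝ} (hη : 0 < η) (hx : P.F.acceptProbOn 0 x ≤ 1 / 2 - η) :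
    1 - 1 / (4 * K P x.length * η ^ 2) ≤ (family P).kernelProb 0 x {y | majF P (boolPair x y) = [false]} :=
  kernelProb_majF_ge x false hη (by rw [sum_filter_blockState_wire0_false]; linarith)

end PolyCopies

/-! ### The amplified family: `K(n)` copies, then the classical majority -/

open _root_.Computability Complexity Cryptography Finset in
/-- **Majority-vote amplification with polynomially many copies** (Bennett–Bernstein–Brassard–Vazirani
1997, Thm. 4.13, in the tree's uniform Clifford+T circuit model): for every polynomial-time uniform,
oracle-free family `F`, every polynomial `pK` and every `η > 0` there is a polynomial-time uniform,
oracle-free family `F'` — `K(n) = pK(n) + 1` parallel copies of `F` (`PolyCopies.family`) followed by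
the classical polynomial-time majority read-out (`CWrap.family` with `PolyCopies.majF`) — which accepts
with probability `≥ 1 − 1/(4 K(|x|) η²)` every input `x` that `F` accepts with probability `≥ 1/2 + η`,
and with probability `≤ 1/(4 K(|x|) η²)` every input that `F` accepts with probability `≤ 1/2 − η`.
[cite: BennettBernsteinBrassardVazirani1997, Thm. 4.13] -/
theorem exists_poly_amplified {F : QCircuitFamily cliffordT} (hF : F.IsOracleFree) (hU : F.IsUniform)
    (pK : Polynomial ℕ) {η : ℝ} (hη : 0 < η) :
    ∃ F' : QCircuitFamily cliffordT, F'.IsOracleFree ∧ F'.IsUniform ∧ ∀ x : List Bool,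
      (1 / 2 + η ≤ F.acceptProbOn 0 x → 1 - 1 / (4 * (pK.eval x.length + 1 : ℕ) * η ^ 2) ≤ F'.acceptProbOn 0 x) ∧
      (F.acceptProbOn 0 x ≤ 1 / 2 - η → F'.acceptProbOn 0 x ≤ 1 / (4 * (pK.eval x.length + 1 : ℕ) * η ^ 2)) := by
  obtain ⟨pF, hpF⟩ := QCircuitFamily.IsUniform.isPolySize' hU
  let P₀ : PolyCopies.Params := ⟨F, pF, fun n => (hpF n).2, pK⟩
  have hRfree : (PolyCopies.family P₀).IsOracleFree := PolyCopies.family_isOracleFree P₀ hF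
  have hRU : (PolyCopies.family P₀).IsUniform := PolyCopies.family_isUniform P₀ hU
  obtain ⟨P, hPh, hPg, hPF⟩ := CWrap.exists_params (PolyTimeComputable.id _) (PolyCopies.majF_mem_FP (P := P₀)) hRU
  have hK : ∀ x : List Bool, PolyCopies.K P₀ x.length = pK.eval x.length + 1 := fun x => rfl
  refine ⟨CWrap.family P, CWrap.family_isOracleFree P (hPF ▸ hRfree), CWrap.family_isUniform P (hPF ▸ hRU),
    fun x => ⟨fun hx => ?_, fun hx => ?_⟩⟩
  · have hker := CWrap.kernelProb_family_ge P x (fun _ => {y | PolyCopies.majF P₀ (boolPair x y) = [true]})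
    rw [hPh, hPg, hPF] at hker
    have hsub : {z | ∃ y ∈ ({y | PolyCopies.majF P₀ (boolPair x y) = [true]} : Set (List Bool)),
        PolyCopies.majF P₀ (boolPair x y) <+: z} ⊆ {z | [true] <+: z} := by
      rintro z ⟨y, hy, hz⟩
      rw [Set.mem_setOf_eq] at hy
      rw [hy] at hz
      exact hz
    rw [← kernelProb_prefix_true_eq_acceptProbOn, ← hK]
    exact ((PolyCopies.kernelProb_majF_true_ge (P := P₀) x hη hx).trans hker).trans ((CWrap.family P).kernelProb_mono 0 x hsub)
  · have hker := CWrap.kernelProb_family_ge P x (fun _ => {y | PolyCopies.majF P₀ (boolPair x y) = [false]})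
    rw [hPh, hPg, hPF] at hker
    have hsub : {z | ∃ y ∈ ({y | PolyCopies.majF P₀ (boolPair x y) = [false]} : Set (List Bool)),
        PolyCopies.majF P₀ (boolPair x y) <+: z} ⊆ {z | [false] <+: z} := by
      rintro z ⟨y, hy, hz⟩
      rw [Set.mem_setOf_eq] at hy
      rw [hy] at hz
      exact hz
    have h1 := ((PolyCopies.kernelProb_majF_false_ge (P := P₀) x hη hx).trans hker).trans ((CWrap.family P).kernelProb_mono 0 x hsub)
    have h2 := kernelProb_add_kernelProb_le_one (CWrap.family P) 0 x disjoint_prefix_true_false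
    rw [kernelProb_prefix_true_eq_acceptProbOn] at h2
    rw [← hK]
    linarith

open _root_.Computability Complexity Cryptography in
/-- **`BQP` with inverse-polynomial error** (Bennett–Bernstein–Brassard–Vazirani 1997, Thm. 4.13 with
`k = 36 (n+1)² + 1` copies; Bernstein–Vazirani 1997, Thm. 8.5): every `A ∈ BQP` is decided by a
polynomial-time uniform, oracle-free Clifford+T family whose two-sided error on inputs of length `n` is
at most `1/(4 (n+1)²)`. [cite: BennettBernsteinBrassardVazirani1997, Thm. 4.13] -/
theorem exists_uniform_family_inv_poly_error {A : Language Bool} (hA : A ∈ BQP) :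
    ∃ F : QCircuitFamily cliffordT, F.IsOracleFree ∧ F.IsUniform ∧ ∀ x : List Bool,
      (x ∈ A → 1 - 1 / (4 * ((x.length : ℝ) + 1) ^ 2) ≤ F.acceptProbOn 0 x) ∧
      (x ∉ A → F.acceptProbOn 0 x ≤ 1 / (4 * ((x.length : ℝ) + 1) ^ 2)) := by
  obtain ⟨F, hFfree, hFU, hF⟩ := ClassBQP.mem_BQP_iff.1 hA
  obtain ⟨F', hF'free, hF'U, hF'⟩ := exists_poly_amplified hFfree hFU (Polynomial.C 36 * (Polynomial.X + 1) ^ 2)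
    (η := 1 / 6) (by norm_num)
  refine ⟨F', hF'free, hF'U, fun x => ?_⟩
  have hKx : ((Polynomial.eval x.length (Polynomial.C 36 * (Polynomial.X + 1) ^ 2) + 1 : ℕ) : ℝ) = 36 * ((x.length : ℝ) + 1) ^ 2 + 1 := by
    push_cast [Polynomial.eval_mul, Polynomial.eval_C, Polynomial.eval_pow, Polynomial.eval_add, Polynomial.eval_X, Polynomial.eval_one]
    ring
  have hbound : 1 / (4 * ((Polynomial.eval x.length (Polynomial.C 36 * (Polynomial.X + 1) ^ 2) + 1 : ℕ) : ℝ) * (1 / 6 : ℝ) ^ 2) ≤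
      1 / (4 * ((x.length : ℝ) + 1) ^ 2) := by
    rw [hKx]
    have hpos : (0 : ℝ) < 4 * ((x.length : ℝ) + 1) ^ 2 := by positivity
    refine one_div_le_one_div_of_le hpos ?_
    have e : 4 * (36 * ((x.length : ℝ) + 1) ^ 2 + 1) * (1 / 6 : ℝ) ^ 2 = 4 * ((x.length : ℝ) + 1) ^ 2 + 1 / 9 := by ring
    rw [e]
    linarith
  constructor
  · intro hx
    have h := (hF' x).1 (by have := (hF x).1 hx; linarith)
    linarith
  · intro hx
    have h := (hF' x).2 (by have := (hF x).2 hx; linarith)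
    linarith

end Literature.Computability.QuantumComplexity

end
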